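import Mathlib
import Literature.NumberTheory.EllipticCurves.KramerCurvesPadic
import Literature.NumberTheory.EllipticCurves.GlobalMinimalModelProofs
import Summits.Parity.BatemanHorn.Theses.IsogenyRedei
import HarnessLib

/-!
# Route IsogenyRedei, item `PencilSplitFibres` (stmt-Parity-11587): the bad fibres of the
# 2-isogenous pencil `E_t : y² = x³ + 2t·x² + (t² + 1)·x` are split multiplicative

For `t ≥ 1` and an odd prime `p`, the Weierstrass equation `E_t = [0, 2t, 0, t² + 1, 0]` over
`ℚ_p` has

* SPLIT MULTIPLICATIVE reduction over `ℤ_p` when `p ∣ t² + 1`;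
* GOOD reduction over `ℤ_p` when `p ∤ t² + 1`,

in the sense of Mathlib's classes `WeierstrassCurve.HasSplitMultiplicativeReduction` /
`WeierstrassCurve.HasGoodReduction` (which include minimality of the GIVEN equation).

Proof (Tate's algorithm, first two lines; Silverman *AEC* VII.1 Remark 1.1 and VII.5 Prop. 5.1).
The invariants are `c₄ = 16(t² − 3) = 16(t² + 1) − 64`, `Δ = −64(t² + 1)²`, and Mathlib's
node-tangent polynomial `c₄T² + a₁c₄T − (54b₆ − 3b₂b₄ + a₂c₄)` equals
`(16(t² + 1) − 64)·T² + 0·T + (16t(t² + 1) + 128t)`.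

* If `p ∣ t² + 1` then `c₄ ≡ −64` is a `p`-adic unit (`p` odd), so the integral equation is minimal
  (`WeierstrassCurve.isMinimal_of_valuation_c₄_eq_one`) with `Δ ≡ 0`: multiplicative reduction.
  Writing `τ` for `t mod p`, `τ² = −1` gives `(τ + 1)² = 2τ`, hence the node-tangent polynomial
  reduces to `−64·T² + 128τ = −64 (T − (τ + 1))(T + (τ + 1))`, which splits over `𝔽_p`: the
  reduction is SPLIT. (This replaces the Legendre-symbol computation `(2t|p) = (2|p)(t|p) = +1`
  of the route text by an explicit square root of `2τ`.)
* If `p ∤ t² + 1` then `Δ = −64(t² + 1)²` is a `p`-adic unit, so the equation is minimal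
  (`WeierstrassCurve.isMinimal_of_valuation_Δ_eq_one`) with good reduction.

The hypothesis `1 ≤ t` of the item is not needed and is discarded.

No definitions, no named facts; Mathlib + two tree lemmas on minimality over a DVR.

## References

* J. H. Silverman, *The Arithmetic of Elliptic Curves*, GTM 106, 2nd ed. (2009), VII.1 Remark 1.1,
  VII.5 Prop. 5.1. [cite: SilvermanAEC2009, VII.1 Rem. 1.1 and VII.5 Prop. 5.1]
-/

noncomputable section

open IsLocalRing IsDedekindDomain Polynomial WeierstrassCurve

namespace Summit.Parity.BatemanHorn.Theorems

namespace PencilSplitFibres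

/-! ### Invariants of `[0, 2t, 0, t² + 1, 0]` over any commutative ring -/

section Ring

variable {R : Type*} [CommRing R]

/-- `c₄(E_t) = 16(t² + 1) − 64` (`= 16(t² − 3)`). [folklore] -/
theorem c₄_pencil (t : R) :
    (⟨0, 2 * t, 0, t ^ 2 + 1, 0⟩ : WeierstrassCurve R).c₄ = 16 * (t ^ 2 + 1) - 64 := by
  simp only [WeierstrassCurve.c₄, WeierstrassCurve.b₂, WeierstrassCurve.b₄]; ring

/-- `Δ(E_t) = −64 (t² + 1)²`. [folklore] -/
theorem Δ_pencil (t : R) :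
    (⟨0, 2 * t, 0, t ^ 2 + 1, 0⟩ : WeierstrassCurve R).Δ = -64 * (t ^ 2 + 1) ^ 2 := by
  simp only [WeierstrassCurve.Δ, WeierstrassCurve.b₂, WeierstrassCurve.b₄, WeierstrassCurve.b₆,
    WeierstrassCurve.b₈]; ring

/-- The constant term of Mathlib's node-tangent polynomial of `E_t`:
`54 b₆ − 3 b₂ b₄ + a₂ c₄ = −(16 t (t² + 1) + 128 t)` (`= −16t(t² + 9)`). [folklore] -/
theorem nodalConst_pencil (t : R) :
    letI I : WeierstrassCurve R := ⟨0, 2 * t, 0, t ^ 2 + 1, 0⟩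
    54 * I.b₆ - 3 * I.b₂ * I.b₄ + I.a₂ * I.c₄ = -(16 * t * (t ^ 2 + 1) + 128 * t) := by
  simp only [WeierstrassCurve.c₄, WeierstrassCurve.b₂, WeierstrassCurve.b₄, WeierstrassCurve.b₆]
  ring

/-- Over a commutative ring in which `τ² + 1 = 0`, the reduced node-tangent polynomial
`−64·T² + 0·T − (−128τ)` factors as `−64 (T − (τ + 1))(T + (τ + 1))`, because `(τ + 1)² = 2τ`.
[folklore] -/
theorem nodal_factor {k : Type*} [CommRing k] (τ : k) (hτ : τ ^ 2 + 1 = 0) :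
    (C (-64 : k) * X ^ 2 + C (0 : k) * X - C (-(128 * τ)) : k[X]) =
      C (-64 : k) * ((X - C (τ + 1)) * (X + C (τ + 1))) := by
  have hσ : (C τ : k[X]) ^ 2 + 1 = 0 := by
    have h := congrArg (C : k → k[X]) hτ
    simpa using h
  simp only [map_neg, map_mul, map_add, map_one, map_zero, map_ofNat]
  linear_combination (-64 : k[X]) * hσ

end Ring

/-! ### The equation `E_t` over `ℚ_p` and its integral model over `ℤ_p` -/

section Padic

variable (p : ℕ) [hp : Fact p.Prime]

/-- `E_t ⊗ ℚ_p` is the base change of the `ℤ_p`-integral equation `[0, 2t, 0, t² + 1, 0]`.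
[folklore] -/
theorem baseChange_pencil_padicInt (t : ℕ) :
    (⟨0, 2 * (t : ℤ_[p]), 0, (t : ℤ_[p]) ^ 2 + 1, 0⟩ : WeierstrassCurve ℤ_[p]).baseChange ℚ_[p] =
      ⟨0, 2 * (t : ℚ_[p]), 0, (t : ℚ_[p]) ^ 2 + 1, 0⟩ := by
  simp only [WeierstrassCurve.baseChange, WeierstrassCurve.map, map_zero, map_mul, map_add,
    map_one, map_pow, map_natCast, map_ofNat]

/-- `E_t / ℚ_p` is `ℤ_p`-integral (a theorem, used via `haveI`). [folklore] -/
theorem isIntegral_pencil (t : ℕ) :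
    (⟨0, 2 * (t : ℚ_[p]), 0, (t : ℚ_[p]) ^ 2 + 1, 0⟩ : WeierstrassCurve ℚ_[p]).IsIntegral ℤ_[p] :=
  ⟨⟨_, (baseChange_pencil_padicInt p t).symm⟩⟩

/-- Mathlib's integral model of `E_t / ℚ_p` is `[0, 2t, 0, t² + 1, 0]` over `ℤ_p` (base change
along the injective `ℤ_p → ℚ_p` is injective on Weierstrass equations). [folklore] -/
theorem integralModel_pencil (t : ℕ) :
    haveI := isIntegral_pencil p t
    (⟨0, 2 * (t : ℚ_[p]), 0, (t : ℚ_[p]) ^ 2 + 1, 0⟩ : WeierstrassCurve ℚ_[p]).integralModel ℤ_[p] =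
      ⟨0, 2 * (t : ℤ_[p]), 0, (t : ℤ_[p]) ^ 2 + 1, 0⟩ := by
  haveI := isIntegral_pencil p t
  apply WeierstrassCurve.map_injective (f := algebraMap ℤ_[p] ℚ_[p]) (IsFractionRing.injective _ _)
  change ((⟨0, 2 * (t : ℚ_[p]), 0, (t : ℚ_[p]) ^ 2 + 1, 0⟩ : WeierstrassCurve ℚ_[p]).integralModel
      ℤ_[p]).baseChange ℚ_[p] =
    (⟨0, 2 * (t : ℤ_[p]), 0, (t : ℤ_[p]) ^ 2 + 1, 0⟩ : WeierstrassCurve ℤ_[p]).baseChange ℚ_[p]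
  rw [baseChange_integralModel_eq, baseChange_pencil_padicInt]

/-- A natural number lies in `𝔪_{ℤ_p}` iff `p` divides it. [folklore] -/
theorem natCast_mem_maximalIdeal_iff (n : ℕ) : (n : ℤ_[p]) ∈ maximalIdeal ℤ_[p] ↔ p ∣ n := by
  rw [IsLocalRing.mem_maximalIdeal, PadicInt.mem_nonunits, ← Int.cast_natCast,
    PadicInt.norm_int_lt_one_iff_dvd, Int.natCast_dvd_natCast]

variable {p}

/-- For an odd prime `p`, `64 ∉ 𝔪_{ℤ_p}`. [folklore] -/
theorem sixtyfour_not_mem_maximalIdeal (hp2 : p ≠ 2) : (64 : ℤ_[p]) ∉ maximalIdeal ℤ_[p] := by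
  intro h
  have h' : ((64 : ℕ) : ℤ_[p]) ∈ maximalIdeal ℤ_[p] := by exact_mod_cast h
  rw [natCast_mem_maximalIdeal_iff] at h'
  have h2 : p ∣ 2 := hp.out.dvd_of_dvd_pow (show p ∣ 2 ^ 6 by simpa using h')
  exact hp2 ((Nat.prime_dvd_prime_iff_eq hp.out Nat.prime_two).mp h2)

/-- If `p ∣ t² + 1` then `t² + 1 ∈ 𝔪_{ℤ_p}`. [folklore] -/
theorem sq_add_one_mem_maximalIdeal {t : ℕ} (hpt : p ∣ t ^ 2 + 1) :
    (t : ℤ_[p]) ^ 2 + 1 ∈ maximalIdeal ℤ_[p] := by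
  have h := (natCast_mem_maximalIdeal_iff p (t ^ 2 + 1)).mpr hpt
  push_cast at h
  exact h

/-- If `p ∣ t² + 1` and `p` is odd then `c₄(E_t) = 16(t² + 1) − 64 ∉ 𝔪_{ℤ_p}`. [folklore] -/
theorem c₄_pencil_not_mem_maximalIdeal (hp2 : p ≠ 2) {t : ℕ} (hpt : p ∣ t ^ 2 + 1) :
    (⟨0, 2 * (t : ℤ_[p]), 0, (t : ℤ_[p]) ^ 2 + 1, 0⟩ : WeierstrassCurve ℤ_[p]).c₄ ∉
      maximalIdeal ℤ_[p] := by
  intro h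
  rw [c₄_pencil] at h
  have h64 : (64 : ℤ_[p]) ∈ maximalIdeal ℤ_[p] := by
    have e : (64 : ℤ_[p]) = 16 * ((t : ℤ_[p]) ^ 2 + 1) - (16 * ((t : ℤ_[p]) ^ 2 + 1) - 64) := by
      ring
    rw [e]
    exact Ideal.sub_mem _ (Ideal.mul_mem_left _ _ (sq_add_one_mem_maximalIdeal hpt)) h
  exact sixtyfour_not_mem_maximalIdeal hp2 h64

/-- If `p ∣ t² + 1` then `Δ(E_t) = −64(t² + 1)² ∈ 𝔪_{ℤ_p}`. [folklore] -/
theorem Δ_pencil_mem_maximalIdeal {t : ℕ} (hpt : p ∣ t ^ 2 + 1) :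
    (⟨0, 2 * (t : ℤ_[p]), 0, (t : ℤ_[p]) ^ 2 + 1, 0⟩ : WeierstrassCurve ℤ_[p]).Δ ∈
      maximalIdeal ℤ_[p] := by
  rw [Δ_pencil]
  exact Ideal.mul_mem_left _ _ (Ideal.pow_mem_of_mem _ (sq_add_one_mem_maximalIdeal hpt) 2 two_pos)

/-- If `p ∤ t² + 1` and `p` is odd then `Δ(E_t) = −64(t² + 1)² ∉ 𝔪_{ℤ_p}`. [folklore] -/
theorem Δ_pencil_not_mem_maximalIdeal (hp2 : p ≠ 2) {t : ℕ} (hpt : ¬ p ∣ t ^ 2 + 1) :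
    (⟨0, 2 * (t : ℤ_[p]), 0, (t : ℤ_[p]) ^ 2 + 1, 0⟩ : WeierstrassCurve ℤ_[p]).Δ ∉
      maximalIdeal ℤ_[p] := by
  intro h
  rw [Δ_pencil, neg_mul, Ideal.neg_mem_iff] at h
  rcases (Ideal.IsMaximal.isPrime (maximalIdeal.isMaximal ℤ_[p])).mem_or_mem h with h64 | hsq
  · exact sixtyfour_not_mem_maximalIdeal hp2 h64
  · have h1 := (Ideal.IsMaximal.isPrime (maximalIdeal.isMaximal ℤ_[p])).mem_of_pow_mem 2 hsq
    have h2 : ((t ^ 2 + 1 : ℕ) : ℤ_[p]) ∈ maximalIdeal ℤ_[p] := by push_cast; exact h1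
    exact hpt ((natCast_mem_maximalIdeal_iff p _).mp h2)

/-- `v_p(c₄(E_t / ℚ_p)) = 1` (unit `c₄`) for `p` odd, `p ∣ t² + 1`. [folklore] -/
theorem valuation_c₄_pencil (hp2 : p ≠ 2) {t : ℕ} (hpt : p ∣ t ^ 2 + 1) :
    (IsDiscreteValuationRing.maximalIdeal ℤ_[p]).valuation ℚ_[p]
      (⟨0, 2 * (t : ℚ_[p]), 0, (t : ℚ_[p]) ^ 2 + 1, 0⟩ : WeierstrassCurve ℚ_[p]).c₄ = 1 := by
  rw [← baseChange_pencil_padicInt, WeierstrassCurve.baseChange, map_c₄,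
    HeightOneSpectrum.valuation_eq_one_iff_notMem]
  exact c₄_pencil_not_mem_maximalIdeal hp2 hpt

/-- `v_p(Δ(E_t / ℚ_p)) < 1` for `p ∣ t² + 1`. [folklore] -/
theorem valuation_Δ_pencil_lt_one {t : ℕ} (hpt : p ∣ t ^ 2 + 1) :
    (IsDiscreteValuationRing.maximalIdeal ℤ_[p]).valuation ℚ_[p]
      (⟨0, 2 * (t : ℚ_[p]), 0, (t : ℚ_[p]) ^ 2 + 1, 0⟩ : WeierstrassCurve ℚ_[p]).Δ < 1 := by
  rw [← baseChange_pencil_padicInt, WeierstrassCurve.baseChange, map_Δ,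
    HeightOneSpectrum.valuation_lt_one_iff_mem]
  exact Δ_pencil_mem_maximalIdeal hpt

/-- `v_p(Δ(E_t / ℚ_p)) = 1` (unit discriminant) for `p` odd, `p ∤ t² + 1`. [folklore] -/
theorem valuation_Δ_pencil_eq_one (hp2 : p ≠ 2) {t : ℕ} (hpt : ¬ p ∣ t ^ 2 + 1) :
    (IsDiscreteValuationRing.maximalIdeal ℤ_[p]).valuation ℚ_[p]
      (⟨0, 2 * (t : ℚ_[p]), 0, (t : ℚ_[p]) ^ 2 + 1, 0⟩ : WeierstrassCurve ℚ_[p]).Δ = 1 := by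
  rw [← baseChange_pencil_padicInt, WeierstrassCurve.baseChange, map_Δ,
    HeightOneSpectrum.valuation_eq_one_iff_notMem]
  exact Δ_pencil_not_mem_maximalIdeal hp2 hpt

/-- **`E_t / ℚ_p` has multiplicative reduction over `ℤ_p`** for `p` odd, `p ∣ t² + 1`
(unit `c₄` ⇒ minimal, Silverman VII.1 Rem. 1.1; `Δ ≡ 0`). [cite: SilvermanAEC2009, VII.5 Prop. 5.1] -/
theorem hasMultiplicativeReduction_pencil (hp2 : p ≠ 2) {t : ℕ} (hpt : p ∣ t ^ 2 + 1) :
    (⟨0, 2 * (t : ℚ_[p]), 0, (t : ℚ_[p]) ^ 2 + 1, 0⟩ : WeierstrassCurve ℚ_[p])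
      |>.HasMultiplicativeReduction ℤ_[p] :=
  haveI := isIntegral_pencil p t
  haveI : (⟨0, 2 * (t : ℚ_[p]), 0, (t : ℚ_[p]) ^ 2 + 1, 0⟩ : WeierstrassCurve ℚ_[p]).IsMinimal
      ℤ_[p] := isMinimal_of_valuation_c₄_eq_one _ (valuation_c₄_pencil hp2 hpt)
  { badReduction := valuation_Δ_pencil_lt_one hpt
    multiplicativeReduction := valuation_c₄_pencil hp2 hpt }

/-- The node-tangent polynomial of `[0, 2t, 0, t² + 1, 0] / ℤ_p` reduces, modulo `p ∣ t² + 1`, to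
`−64·T² + 0·T − (−128 τ)` with `τ = t mod p`. [folklore] -/
theorem nodalTangents_pencil_residue {t : ℕ} (hpt : p ∣ t ^ 2 + 1) :
    letI I : WeierstrassCurve ℤ_[p] := ⟨0, 2 * (t : ℤ_[p]), 0, (t : ℤ_[p]) ^ 2 + 1, 0⟩
    Polynomial.map (algebraMap ℤ_[p] (ResidueField ℤ_[p]))
      (C I.c₄ * X ^ 2 + C (I.a₁ * I.c₄) * X - C (54 * I.b₆ - 3 * I.b₂ * I.b₄ + I.a₂ * I.c₄)) =
      C (-64 : ResidueField ℤ_[p]) * X ^ 2 + C (0 : ResidueField ℤ_[p]) * X -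
        C (-(128 * residue ℤ_[p] (t : ℤ_[p]))) := by
  set f := residue ℤ_[p] with hf
  have h0 : f ((t : ℤ_[p]) ^ 2 + 1) = 0 := by
    rw [hf, residue_eq_zero_iff]
    exact sq_add_one_mem_maximalIdeal hpt
  have e1 : f (⟨0, 2 * (t : ℤ_[p]), 0, (t : ℤ_[p]) ^ 2 + 1, 0⟩ : WeierstrassCurve ℤ_[p]).c₄ =
      -64 := by
    rw [c₄_pencil, map_sub, map_mul, h0, mul_zero, zero_sub, map_ofNat]
  have e2 : f ((⟨0, 2 * (t : ℤ_[p]), 0, (t : ℤ_[p]) ^ 2 + 1, 0⟩ : WeierstrassCurve ℤ_[p]).a₁ *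
      (⟨0, 2 * (t : ℤ_[p]), 0, (t : ℤ_[p]) ^ 2 + 1, 0⟩ : WeierstrassCurve ℤ_[p]).c₄) = 0 := by
    rw [show (⟨0, 2 * (t : ℤ_[p]), 0, (t : ℤ_[p]) ^ 2 + 1, 0⟩ : WeierstrassCurve ℤ_[p]).a₁ = 0
      from rfl, zero_mul, map_zero]
  have e3 : letI I : WeierstrassCurve ℤ_[p] := ⟨0, 2 * (t : ℤ_[p]), 0, (t : ℤ_[p]) ^ 2 + 1, 0⟩
      f (54 * I.b₆ - 3 * I.b₂ * I.b₄ + I.a₂ * I.c₄) = -(128 * f (t : ℤ_[p])) := by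
    rw [nodalConst_pencil, map_neg, map_add, map_mul, map_mul, h0, mul_zero, zero_add, map_mul,
      map_ofNat]
  rw [IsLocalRing.ResidueField.algebraMap_eq, Polynomial.map_sub, Polynomial.map_add,
    Polynomial.map_mul, Polynomial.map_mul, Polynomial.map_pow, Polynomial.map_C, Polynomial.map_C,
    Polynomial.map_C, Polynomial.map_X, ← hf, e1, e2, e3]

/-- **`E_t / ℚ_p` has SPLIT multiplicative reduction over `ℤ_p`** for `p` odd, `p ∣ t² + 1`: with
`τ = t mod p`, `τ² = −1` gives `(τ + 1)² = 2τ`, and the node-tangent polynomial reduces to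
`−64 (T − (τ + 1))(T + (τ + 1))`, which splits over `𝔽_p`. [cite: SilvermanAEC2009, VII.5 Prop. 5.1] -/
theorem hasSplitMultiplicativeReduction_pencil (hp2 : p ≠ 2) {t : ℕ} (hpt : p ∣ t ^ 2 + 1) :
    (⟨0, 2 * (t : ℚ_[p]), 0, (t : ℚ_[p]) ^ 2 + 1, 0⟩ : WeierstrassCurve ℚ_[p])
      |>.HasSplitMultiplicativeReduction ℤ_[p] := by
  haveI := hasMultiplicativeReduction_pencil hp2 hpt
  refine ⟨?_⟩
  rw [integralModel_pencil]
  change Splits (Polynomial.map (algebraMap ℤ_[p] (ResidueField ℤ_[p])) _)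
  have hτ : (residue ℤ_[p] (t : ℤ_[p])) ^ 2 + 1 = 0 := by
    rw [← map_pow, ← map_one (residue ℤ_[p]), ← map_add, residue_eq_zero_iff]
    exact sq_add_one_mem_maximalIdeal hpt
  rw [nodalTangents_pencil_residue hpt, nodal_factor _ hτ]
  exact ((Splits.X_sub_C _).mul (Splits.X_add_C _)).C_mul _

/-- **`E_t / ℚ_p` has good reduction over `ℤ_p`** for `p` odd, `p ∤ t² + 1` (unit discriminant ⇒
minimal with good reduction). [cite: SilvermanAEC2009, VII.1 Rem. 1.1] -/
theorem hasGoodReduction_pencil (hp2 : p ≠ 2) {t : ℕ} (hpt : ¬ p ∣ t ^ 2 + 1) :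
    (⟨0, 2 * (t : ℚ_[p]), 0, (t : ℚ_[p]) ^ 2 + 1, 0⟩ : WeierstrassCurve ℚ_[p])
      |>.HasGoodReduction ℤ_[p] :=
  haveI := isIntegral_pencil p t
  haveI : (⟨0, 2 * (t : ℚ_[p]), 0, (t : ℚ_[p]) ^ 2 + 1, 0⟩ : WeierstrassCurve ℚ_[p]).IsMinimal
      ℤ_[p] := isMinimal_of_valuation_Δ_eq_one _ (valuation_Δ_pencil_eq_one hp2 hpt)
  { goodReduction := valuation_Δ_pencil_eq_one hp2 hpt }

end Padic

end PencilSplitFibres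

/-- **Item `PencilSplitFibres` of route IsogenyRedei (stmt-Parity-11587), proved**: for `t ≥ 1` and
every odd prime `p`, the equation `[0, 2t, 0, t² + 1, 0] / ℚ_p` has split multiplicative reduction
over `ℤ_p` if `p ∣ t² + 1` and good reduction over `ℤ_p` if `p ∤ t² + 1`.
[cite: SilvermanAEC2009, VII.1 Rem. 1.1 and VII.5 Prop. 5.1] -/
theorem pencilSplitFibres_proof : Summit.Parity.BatemanHorn.Theses.IsogenyRedei.PencilSplitFibres := by
  unfold Summit.Parity.BatemanHorn.Theses.IsogenyRedei.PencilSplitFibres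
  intro t _ p _ hp2
  exact ⟨fun hpt => PencilSplitFibres.hasSplitMultiplicativeReduction_pencil hp2 hpt,
    fun hpt => PencilSplitFibres.hasGoodReduction_pencil hp2 hpt⟩

end Summit.Parity.BatemanHorn.Theorems

end
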